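import Literature.AlgebraicGeometry.Resolution.ProperModels
import HarnessLib

/-!
# FrobeniusSandwichClasses — the models half (H = `QuotientModels.HeightOneDescent`, 27195) cut by the SANDWICH
EXPONENT of a purely-inseparably-unirational function field (decomp-res node «FrobeniusSandwich», lens-5 g8),
route-independent part

Source HOME/decomp-res-lens-5/g8/FrobeniusSandwich.lean (sha256 485175a5c4c88ec4, 245 lines; critic `lean check` rc
0, 0 err, 0 warn, 0 sorry, `pieces_of_summit` axioms standard), CRITIC-LEDGER row 50 (2026-08-30T07:17Z): CLEARED AS
MAP NODE (residual 0 · decision 0 · map +1).  Observation driving the node: EVERY located wild models-half specimen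
field `K` of the cell sits in a FROBENIUS SANDWICH of rational four-space `k(x₁,…,x₄) ⊇ K ⊇ k(x₁^{p^m},…,x₄^{p^m})`
with `m ≤ 2` (hypersurface bed `z^{pᵉ} + F = 0` over a perfect field: exponent `e`; derivation bed `k(x)^δ ⊇ k(xᵖ)`:
exponent 1, index `p`).  The ladder parameter is the sandwich exponent `m`.  This file carries the ROUTE-INDEPENDENT
part verbatim (imports only the Literature structure `ProperModel`): the vocabulary `RatFun k d = Frac k[x₁..x_d]`,
`xv`, the p-radical closure `frobClosure p K = {y : yᵖ ∈ K}` (an intermediate field because Frobenius is additive);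
the pieces `RatSandwichRegModels d m` (FS d m: every exponent-`≤ m` sandwich has a regular proper model; `m = 0` is
`K = k(x)`, KNOWN-MOD-PORT), `RatIndexPDescent d` (the census rung RatH1D: index-`p` subfields `⊇ k(xᵖ)`),
`PIUnirationalRegModels d` (asymptote), `SandwichHeightOneDescent d` (bridge = H on sandwich pairs), the port
`SandwichFieldsPort d` (COSTUME, used as a hypothesis only); and the ladder kernels (all PROVED, bookkeeping:
induction on `m`, `pow_mem`, `add_pow_char`): `ratSandwich_mono`, `piu_iff_forall_ratSandwich` (EXACT asymptote),
`ratIndexP_of_ratSandwich_one`, `ratSandwich_succ_of_bridge` (THE bridge kernel through `frobClosure`),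
`ratSandwich_all_of_zero`, `piu_of_zero_of_bridge`. The links BY NAME to QuotientModels (H 27195, RM 27197, ROOT via
`QuotientModels.closes`) live in `Theorems.QuotientModelsFrobeniusSandwich`.  Tags (critic): models-type ladder, std
(b); FS 4 1 ⊇ RatIndexPDescent 4, FS 4 2 NECESSARY mod port; WEAKER by letter (function-field class), substance
UNDECIDED (étale-locally every H-germ is a sandwich germ ⇒ the restriction is global only, plausibly generic-hard);
LOCATED verified; bridge = H|sandwich, credit 0; ladder SELF-SIMILAR (rung m+1 = H on rung-m fields) ⇒ no
independent finite-range content beyond ℙᵈ; complement (tops not p.i.-unirational) unlocated residual 0.  No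
statement here is a claim: definitions + pure-logic kernels; no instances, no notation.  (Hartshorne 1977
II.4.9/II.8; Blass, Zariski surfaces; Miyanishi–Ito, purely inseparable phenomena; Rudakov–Šafarevič 1976; Jacobson,
Lectures III §IV.8.)
-/

namespace Summit.ResolutionOfSingularities.ResolutionOfSingularities.Theorems.FrobeniusSandwichClasses

open CategoryTheory AlgebraicGeometry
open Literature.AlgebraicGeometry.Resolution

/-! ## Vocabulary: the rational function field and its variables -/

/-- `k(x₁,…,x_d)`: the fraction field of the polynomial ring in `d` variables. -/
abbrev RatFun (k : Type) [Field k] (d : ℕ) : Type := FractionRing (MvPolynomial (Fin d) k)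

/-- the variable `xᵢ ∈ k(x₁,…,x_d)`. -/
noncomputable def xv (k : Type) [Field k] (d : ℕ) (i : Fin d) : RatFun k d :=
  algebraMap (MvPolynomial (Fin d) k) (RatFun k d) (MvPolynomial.X i)

/-- The **p-radical closure** of an intermediate field `K` inside a field `L` of characteristic `p`:
`{y ∈ L : yᵖ ∈ K}` — an intermediate field because Frobenius is additive. -/
def frobClosure {k L : Type} [Field k] [Field L] [Algebra k L] (p : ℕ) [Fact p.Prime] [CharP L p]
    (K : IntermediateField k L) : IntermediateField k L where
  carrier := {y | y ^ p ∈ K}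
  mul_mem' {a b} ha hb := by
    simp only [Set.mem_setOf_eq] at *
    rw [mul_pow]; exact K.mul_mem ha hb
  one_mem' := by simp only [Set.mem_setOf_eq, one_pow]; exact K.one_mem
  add_mem' {a b} ha hb := by
    simp only [Set.mem_setOf_eq] at *
    rw [add_pow_char]; exact K.add_mem ha hb
  zero_mem' := by
    simp only [Set.mem_setOf_eq, zero_pow (Fact.out : p.Prime).ne_zero]; exact K.zero_mem
  algebraMap_mem' c := by
    show (algebraMap k L c) ^ p ∈ K
    rw [← map_pow]; exact K.algebraMap_mem _
  inv_mem' a ha := by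
    show a⁻¹ ^ p ∈ K
    rw [inv_pow]; exact K.inv_mem ha

/-- Membership in the p-radical closure. [folklore] -/
theorem mem_frobClosure {k L : Type} [Field k] [Field L] [Algebra k L] {p : ℕ} [Fact p.Prime] [CharP L p]
    {K : IntermediateField k L} {y : L} : y ∈ frobClosure p K ↔ y ^ p ∈ K := Iff.rfl

/-- `K` lies in its p-radical closure. [folklore] -/
theorem le_frobClosure {k L : Type} [Field k] [Field L] [Algebra k L] {p : ℕ} [Fact p.Prime] [CharP L p]
    (K : IntermediateField k L) : K ≤ frobClosure p K :=
  fun _ hy => pow_mem hy p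

/-! ## The pieces -/

/-- FS d m · finite range / rung · **regular models of Frobenius sandwiches of exponent `m`**: for every prime `p`,
field `k` of characteristic `p` and intermediate field `k ⊆ K ⊆ k(x₁,…,x_d)` containing `xᵢ^{p^m}` for all `i`,
`K` has a regular proper `k`-model.  `m = 0`: `K = k(x)` (ℙᵈ; KNOWN).  `d = 4, m ≤ 2`: contains every held
models-half specimen.  NECESSARY (mod port) · WEAKER by letter · UNDECIDED · IDEA-NEEDED for `m ≥ 1`. -/
def RatSandwichRegModels (d m : ℕ) : Prop :=
  ∀ p : ℕ, p.Prime → ∀ (k : Type) [Field k] [CharP k p] (K : IntermediateField k (RatFun k d)),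
    (∀ i : Fin d, xv k d i ^ p ^ m ∈ K) →
    ∃ N : ProperModel k K, Scheme.IsRegular N.X

/-- RatH1D_d · the census-suggested rung (T-RR-rad-add-1, 2026-08-30T05:12Z) · **index-`p` subfields of `k(x)`
containing `k(xᵖ)`** (= kernels `k(x)^δ` of ONE `p`-closed rational vector field `δ` on `𝔸ᵈ`) have regular proper
models.  `⟸ FS d 1` (kernel `ratIndexP_of_ratSandwich_one`).  Located instances, `d = 4`: the 386 CANDIDATE
derivation quotients of census I32.  NECESSARY · WEAKER · UNDECIDED · IDEA-NEEDED (additive zeros of `δ`). -/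
def RatIndexPDescent (d : ℕ) : Prop :=
  ∀ p : ℕ, p.Prime → ∀ (k : Type) [Field k] [CharP k p] (K : IntermediateField k (RatFun k d)),
    (∀ i : Fin d, xv k d i ^ p ∈ K) → Module.finrank K (RatFun k d) = p →
    ∃ N : ProperModel k K, Scheme.IsRegular N.X

/-- PIUReg d · asymptote · **every purely-inseparably-unirational field `k(x) ⊇ K ⊇ k(x^{p^m})` (some `m`) has a
regular proper model**; `⟺ ∀ m, FS d m` (kernel `piu_iff_forall_ratSandwich`).  NECESSARY (mod port) · UNDECIDED. -/
def PIUnirationalRegModels (d : ℕ) : Prop :=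
  ∀ p : ℕ, p.Prime → ∀ (k : Type) [Field k] [CharP k p] (K : IntermediateField k (RatFun k d)),
    (∃ m : ℕ, ∀ i : Fin d, xv k d i ^ p ^ m ∈ K) →
    ∃ N : ProperModel k K, Scheme.IsRegular N.X

/-- HFS d · bridge · **height-one descent between sandwich fields**: for `k ⊆ K ⊆ K₁ ⊆ k(x₁,…,x_d)` with
`K₁ ∋ xᵢ^{p^m}` (all `i`) and `K₁ᵖ ⊆ K`: if `K₁` has a regular proper model then so has `K`.  `⟸ H 27195`
(kernel `sandwichDescent_of_heightOneDescent`, mod port).  NECESSARY · UNDECIDED · the open core of the ladder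
(quotients of regular models of sandwich fields by one p-closed foliation; additive points). -/
def SandwichHeightOneDescent (d : ℕ) : Prop :=
  ∀ p : ℕ, p.Prime → ∀ (k : Type) [Field k] [CharP k p] (m : ℕ) (K K₁ : IntermediateField k (RatFun k d)),
    K ≤ K₁ → (∀ i : Fin d, xv k d i ^ p ^ m ∈ K₁) → (∀ y : RatFun k d, y ∈ K₁ → y ^ p ∈ K) →
    (∃ N₁ : ProperModel k K₁, Scheme.IsRegular N₁.X) → ∃ N : ProperModel k K, Scheme.IsRegular N.X

/-- SFM d · PORT (COSTUME(cite): folklore — an intermediate field of a finitely generated extension is finitely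
generated; a finitely generated field has a proper (projective) model; `k(x)` is finite over `k(x^{p^m})`, hence a
sandwich field `K₁ ⊇ K` is finite over `K`) · stated for sandwich fields only. -/
def SandwichFieldsPort (d : ℕ) : Prop :=
  ∀ p : ℕ, p.Prime → ∀ (k : Type) [Field k] [CharP k p] (m : ℕ) (K : IntermediateField k (RatFun k d)),
    (∀ i : Fin d, xv k d i ^ p ^ m ∈ K) →
    Algebra.EssFiniteType k K ∧ Nonempty (ProperModel k K) ∧
    ∀ (K₁ : IntermediateField k (RatFun k d)) (hle : K ≤ K₁),
      letI := (IntermediateField.inclusion hle).toRingHom.toAlgebra; Module.Finite K K₁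

/-! ## Kernels of the ladder (no case split on `p`, no degree, no field slice: induction on the sandwich exponent) -/

/-- monotonicity: a deeper rung implies a shallower one. [folklore] -/
theorem ratSandwich_mono {d m m' : ℕ} (hmm : m' ≤ m) (h : RatSandwichRegModels d m) : RatSandwichRegModels d m' := by
  intro p hp k _ _ K hK
  refine h p hp k K fun i => ?_
  have : xv k d i ^ p ^ m = (xv k d i ^ p ^ m') ^ p ^ (m - m') := by
    rw [← pow_mul, ← pow_add, Nat.add_sub_cancel' hmm]
  rw [this]
  exact pow_mem (hK i) _

/-- EXACTNESS of the asymptote: `PIUnirationalRegModels d ⟺ ∀ m, RatSandwichRegModels d m`. [folklore] -/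
theorem piu_iff_forall_ratSandwich {d : ℕ} : PIUnirationalRegModels d ↔ ∀ m, RatSandwichRegModels d m :=
  ⟨fun h m p hp k _ _ K hK => h p hp k K ⟨m, hK⟩, fun h p hp k _ _ K ⟨m, hK⟩ => h m p hp k K hK⟩

/-- the census rung is inside the first sandwich rung: `FS d 1 → RatH1D_d`. [folklore] -/
theorem ratIndexP_of_ratSandwich_one {d : ℕ} (h : RatSandwichRegModels d 1) : RatIndexPDescent d := by
  intro p hp k _ _ K hK _
  exact h p hp k K (by simpa using hK)

/-- THE BRIDGE KERNEL: one more Frobenius layer is one height-one descent inside `k(x)` — through the p-radical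
closure `K₁ = {y : yᵖ ∈ K}`, which is a sandwich field of exponent `m` whenever `K` is one of exponent `m + 1`.
[folklore] -/
theorem ratSandwich_succ_of_bridge {d m : ℕ} (h : RatSandwichRegModels d m) (hB : SandwichHeightOneDescent d) :
    RatSandwichRegModels d (m + 1) := by
  intro p hp k _ _ K hK
  haveI : Fact p.Prime := ⟨hp⟩
  haveI : CharP (RatFun k d) p := charP_of_injective_algebraMap (algebraMap k (RatFun k d)).injective p
  let K₁ : IntermediateField k (RatFun k d) := frobClosure p K
  have hK₁ : ∀ i : Fin d, xv k d i ^ p ^ m ∈ K₁ := fun i => by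
    show (xv k d i ^ p ^ m) ^ p ∈ K
    rw [← pow_mul, ← pow_succ]
    exact hK i
  exact hB p hp k m K K₁ (le_frobClosure K) hK₁ (fun y hy => hy) (h p hp k K₁ hK₁)

/-- **finite range + bridge ⇒ every rung**: `FS d 0 → HFS d → ∀ m, FS d m`. [folklore] -/
theorem ratSandwich_all_of_zero {d : ℕ} (h0 : RatSandwichRegModels d 0) (hB : SandwichHeightOneDescent d) :
    ∀ m, RatSandwichRegModels d m
  | 0 => h0
  | m + 1 => ratSandwich_succ_of_bridge (ratSandwich_all_of_zero h0 hB m) hB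

/-- hence the asymptote from the base rung and the bridge. [folklore] -/
theorem piu_of_zero_of_bridge {d : ℕ} (h0 : RatSandwichRegModels d 0) (hB : SandwichHeightOneDescent d) :
    PIUnirationalRegModels d :=
  piu_iff_forall_ratSandwich.mpr (ratSandwich_all_of_zero h0 hB)

end Summit.ResolutionOfSingularities.ResolutionOfSingularities.Theorems.FrobeniusSandwichClasses
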